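import Literature.MathematicalPhysics.QuantumLattice.AnisotropicHeisenbergGaussianDomination
import HarnessLib

/-!
# Reflection positivity of the Heisenberg antiferromagnet in the COUPLINGS
# (Lieb–Nachtergaele 1995, proof of Theorem 4; Dyson–Lieb–Simon 1978)

E. H. Lieb, B. Nachtergaele, *Stability of the Peierls instability for ring-shaped molecules*,
Phys. Rev. B **51** (1995) 4777 (= cond-mat/9410100), §3, proof of Theorem 4: "The Heisenberg
antiferromagnet on an arbitrary bipartite lattice is reflection positive [DLS]. This implies … the
following inequality, analogous to Lemma 3.1 (`RPineq`):
`λ₀(H_Heis({J^(l), J^(m), J^(r)})) ≥ ½(λ₀(H_Heis({J^(l), J^(m), J^(l)})) + λ₀(H_Heis({J^(r), J^(m), J^(r)})))`,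
where `{J^(l), J^(m), J^(r)}` denotes a partition of the coupling constants into three groups: the
couplings on the bonds to the left of any reflection plane of the lattice, the couplings on the
bonds intersected by the plane, and the couplings to the right of the plane."

The tree's `AnisotropicHeisenbergGaussianDomination.lean` proves the Kennedy–Lieb–Shastry /
Dyson–Lieb–Simon reflection inequality for the weighted antiferromagnet
`H_w(h) = Σ_{⟨xy⟩} w_{xy}[𝐒_x·𝐒_y - …]` on the torus `(ℤ/Lℤ)^d` (any spin `n/2`, even side `L ≥ 4`)
for weights `w` INVARIANT under the reflection (`heis_groundEnergy_reflect_le_weighted`, the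
reflection acting on the field `h`). This file removes that restriction: the reflection acts on
the couplings themselves,

* `reflectWeightLeft L j a w` (`J^(l), J^(m), θJ^(l)`): `w` on the left and crossing bonds,
  `w ∘ θ` on the right bonds; `reflectWeightRight L j a w` (`θJ^(r), J^(m), J^(r)`);
* `heisWeightedRealFieldHamiltonian_eq_submatrix_general` — the Kronecker form
  `H♭_w(g) = A_w(g) ⊗ 1 + 1 ⊗ A_{w∘θ}(g∘θ) - Σᵢ Mᵢ ⊗ Nᵢ` for ARBITRARY weights (only the
  crossing couplings, which are automatically `θ`-invariant, enter `Mᵢ, Nᵢ` through `√w`);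
* **`heis_groundEnergy_reflectWeight_le`** — for couplings nonnegative on the crossing bonds and
  every field `h`: `½(E₀(H_{w^L}(h^L)) + E₀(H_{w^R}(h^R))) ≤ E₀(H_w(h))`, and its zero-field form
  **`heis_groundEnergy_reflectWeight_le_zero`**, Lieb–Nachtergaele's displayed inequality, for
  the torus `(ℤ/Lℤ)^d` of even side `L ≥ 4`, any `d ≥ 1`, any spin.

## References

* [LiebNachtergaele1995] E. H. Lieb, B. Nachtergaele, Phys. Rev. B 51 (1995) 4777, §3 (proof of
  Theorem 4, the displayed inequality).
* [DLS1978] F. J. Dyson, E. H. Lieb, B. Simon, J. Stat. Phys. 18 (1978) 335–383, Lemma 4.1,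
  Lemma 6.1, Thm. 6.1 (reflection positivity of the antiferromagnet in planes between sites).
* [KLS1988JSP] T. Kennedy, E. H. Lieb, B. S. Shastry, J. Stat. Phys. 53 (1988) 1019–1030,
  eqs. (20)–(25) (the ground-state form of the reflection inequality).
-/

noncomputable section

open Matrix Finset NormedSpace
open scoped ComplexOrder Kronecker
open Literature.MathematicalPhysics.QuantumLattice Literature.MathematicalPhysics.QuantumLattice.SpinOperators
  Literature.Probability.LatticeModels Literature.Barriers.AtomisticToContinuum.BoseGas

namespace Literature.MathematicalPhysics.QuantumLattice

variable {d : ℕ}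

/-! ### The reflected coupling configurations -/

section Weights

variable (L : ℕ) [NeZero L] (j : Fin d) (a : ZMod L)

/-- **`(J^(l), J^(m), θJ^(l))`**: the couplings kept on the left and crossing bonds and
reflected onto the right bonds. [cite: LiebNachtergaele1995, §3 (proof of Theorem 4)] -/
def reflectWeightLeft (w : Sym2 (TorusSite d L) → ℝ) : Sym2 (TorusSite d L) → ℝ := fun e =>
  if ∀ x ∈ e, x ∉ torusLeftHalf L j a then w (e.map (Torus.reflectBetweenSites j a)) else w e

/-- **`(θJ^(r), J^(m), J^(r))`**: the couplings kept on the right and crossing bonds and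
reflected onto the left bonds. [cite: LiebNachtergaele1995, §3 (proof of Theorem 4)] -/
def reflectWeightRight (w : Sym2 (TorusSite d L) → ℝ) : Sym2 (TorusSite d L) → ℝ := fun e =>
  if ∀ x ∈ e, x ∈ torusLeftHalf L j a then w (e.map (Torus.reflectBetweenSites j a)) else w e

variable {L j a}

/-- Unfolding lemma. [cite: LiebNachtergaele1995, §3] -/
theorem reflectWeightLeft_apply (w : Sym2 (TorusSite d L) → ℝ) (e : Sym2 (TorusSite d L)) :
    reflectWeightLeft L j a w e =
      if ∀ x ∈ e, x ∉ torusLeftHalf L j a then w (e.map (Torus.reflectBetweenSites j a)) else w e :=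
  rfl

/-- Unfolding lemma. [cite: LiebNachtergaele1995, §3] -/
theorem reflectWeightRight_apply (w : Sym2 (TorusSite d L) → ℝ) (e : Sym2 (TorusSite d L)) :
    reflectWeightRight L j a w e =
      if ∀ x ∈ e, x ∈ torusLeftHalf L j a then w (e.map (Torus.reflectBetweenSites j a)) else w e :=
  rfl

/-- Nonnegative couplings stay nonnegative. [cite: LiebNachtergaele1995, §3] -/
theorem reflectWeightLeft_nonneg {w : Sym2 (TorusSite d L) → ℝ} (hw : ∀ e, 0 ≤ w e)
    (e : Sym2 (TorusSite d L)) : 0 ≤ reflectWeightLeft L j a w e := by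
  rw [reflectWeightLeft_apply]; split_ifs <;> exact hw _

/-- Nonnegative couplings stay nonnegative. [cite: LiebNachtergaele1995, §3] -/
theorem reflectWeightRight_nonneg {w : Sym2 (TorusSite d L) → ℝ} (hw : ∀ e, 0 ≤ w e)
    (e : Sym2 (TorusSite d L)) : 0 ≤ reflectWeightRight L j a w e := by
  rw [reflectWeightRight_apply]; split_ifs <;> exact hw _

/-- A left bond is not a right bond. [cite: KLS1988JSP, p. 1027] -/
theorem not_forall_not_mem_of_mem_torusLeftEdges {e : Sym2 (TorusSite d L)}
    (he : e ∈ torusLeftEdges L j a) : ¬∀ x ∈ e, x ∉ torusLeftHalf L j a := by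
  obtain ⟨-, hl⟩ := mem_filter.1 he
  induction e using Sym2.ind with
  | h x y => exact fun h => h x (Sym2.mem_mk_left x y) (hl x (Sym2.mem_mk_left x y))

/-- The mirror image of a left bond is a right bond. [cite: KLS1988JSP, p. 1027] -/
theorem forall_not_mem_map_of_mem_torusLeftEdges (hL : Even L) {e : Sym2 (TorusSite d L)}
    (he : e ∈ torusLeftEdges L j a) :
    ∀ x ∈ e.map (Torus.reflectBetweenSites j a), x ∉ torusLeftHalf L j a := by
  obtain ⟨-, hl⟩ := mem_filter.1 he
  intro x hx
  obtain ⟨y, hy, rfl⟩ := Sym2.mem_map.1 hx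
  exact fun h => (reflectBetweenSites_mem_torusLeftHalf_iff L j a hL y).1 h (hl y hy)

/-- A right bond is not a left bond. [cite: KLS1988JSP, p. 1027] -/
theorem not_forall_mem_of_forall_not_mem {e : Sym2 (TorusSite d L)}
    (he : ∀ x ∈ e, x ∉ torusLeftHalf L j a) : ¬∀ x ∈ e, x ∈ torusLeftHalf L j a := by
  induction e using Sym2.ind with
  | h x y => exact fun h => he x (Sym2.mem_mk_left x y) (h x (Sym2.mem_mk_left x y))

omit [NeZero L] in
/-- A crossing bond is its own mirror image. [cite: KLS1988JSP, p. 1028] -/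
theorem map_crossEdge (x : TorusSite d L) :
    (s(x, Torus.reflectBetweenSites j a x) : Sym2 (TorusSite d L)).map (Torus.reflectBetweenSites j a) =
      s(x, Torus.reflectBetweenSites j a x) := by
  rw [Sym2.map_mk, reflectBetweenSites_reflectBetweenSites, Sym2.eq_swap]

/-- A crossing bond is neither a right bond … [cite: KLS1988JSP, p. 1028] -/
theorem not_forall_not_mem_crossEdge {x : TorusSite d L} (hx : x ∈ torusCrossSites L j a) :
    ¬∀ y ∈ (s(x, Torus.reflectBetweenSites j a x) : Sym2 (TorusSite d L)), y ∉ torusLeftHalf L j a :=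
  fun h => h x (Sym2.mem_mk_left _ _) (mem_torusCrossSites.1 hx).1

/-- … nor a left bond. [cite: KLS1988JSP, p. 1028] -/
theorem not_forall_mem_crossEdge (hL : Even L) {x : TorusSite d L} (hx : x ∈ torusCrossSites L j a) :
    ¬∀ y ∈ (s(x, Torus.reflectBetweenSites j a x) : Sym2 (TorusSite d L)), y ∈ torusLeftHalf L j a :=
  fun h => (reflectBetweenSites_mem_torusLeftHalf_iff L j a hL x).1 (h _ (Sym2.mem_mk_right _ _))
    (mem_torusCrossSites.1 hx).1

/-- `w^L = w` on the left bonds. [cite: LiebNachtergaele1995, §3] -/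
theorem reflectWeightLeft_of_mem_torusLeftEdges (w : Sym2 (TorusSite d L) → ℝ)
    {e : Sym2 (TorusSite d L)} (he : e ∈ torusLeftEdges L j a) : reflectWeightLeft L j a w e = w e := by
  rw [reflectWeightLeft_apply, if_neg (not_forall_not_mem_of_mem_torusLeftEdges he)]

/-- `w^L = w` on the crossing bonds. [cite: LiebNachtergaele1995, §3] -/
theorem reflectWeightLeft_crossEdge (w : Sym2 (TorusSite d L) → ℝ) {x : TorusSite d L}
    (hx : x ∈ torusCrossSites L j a) :
    reflectWeightLeft L j a w s(x, Torus.reflectBetweenSites j a x) =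
      w s(x, Torus.reflectBetweenSites j a x) := by
  rw [reflectWeightLeft_apply, if_neg (not_forall_not_mem_crossEdge hx)]

/-- `w^L = w ∘ θ` on the right bonds. [cite: LiebNachtergaele1995, §3] -/
theorem reflectWeightLeft_of_forall_not_mem (w : Sym2 (TorusSite d L) → ℝ)
    {e : Sym2 (TorusSite d L)} (he : ∀ x ∈ e, x ∉ torusLeftHalf L j a) :
    reflectWeightLeft L j a w e = w (e.map (Torus.reflectBetweenSites j a)) := by
  rw [reflectWeightLeft_apply, if_pos he]

/-- `w^L ∘ θ = w` on the left bonds. [cite: LiebNachtergaele1995, §3] -/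
theorem reflectWeightLeft_map_of_mem_torusLeftEdges (hL : Even L) (w : Sym2 (TorusSite d L) → ℝ)
    {e : Sym2 (TorusSite d L)} (he : e ∈ torusLeftEdges L j a) :
    reflectWeightLeft L j a w (e.map (Torus.reflectBetweenSites j a)) = w e := by
  rw [reflectWeightLeft_of_forall_not_mem w (forall_not_mem_map_of_mem_torusLeftEdges hL he),
    map_reflectBetweenSites_map_reflectBetweenSites]

/-- `w^L ∘ θ = w` on the crossing bonds. [cite: LiebNachtergaele1995, §3] -/
theorem reflectWeightLeft_map_crossEdge (w : Sym2 (TorusSite d L) → ℝ) {x : TorusSite d L}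
    (hx : x ∈ torusCrossSites L j a) :
    reflectWeightLeft L j a w ((s(x, Torus.reflectBetweenSites j a x) : Sym2 (TorusSite d L)).map
        (Torus.reflectBetweenSites j a)) = w s(x, Torus.reflectBetweenSites j a x) := by
  rw [map_crossEdge, reflectWeightLeft_crossEdge w hx]

/-- `w^R = w ∘ θ` on the left bonds. [cite: LiebNachtergaele1995, §3] -/
theorem reflectWeightRight_of_mem_torusLeftEdges (w : Sym2 (TorusSite d L) → ℝ)
    {e : Sym2 (TorusSite d L)} (he : e ∈ torusLeftEdges L j a) :
    reflectWeightRight L j a w e = w (e.map (Torus.reflectBetweenSites j a)) := by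
  rw [reflectWeightRight_apply, if_pos (mem_filter.1 he).2]

/-- `w^R = w` on the crossing bonds. [cite: LiebNachtergaele1995, §3] -/
theorem reflectWeightRight_crossEdge (hL : Even L) (w : Sym2 (TorusSite d L) → ℝ) {x : TorusSite d L}
    (hx : x ∈ torusCrossSites L j a) :
    reflectWeightRight L j a w s(x, Torus.reflectBetweenSites j a x) =
      w s(x, Torus.reflectBetweenSites j a x) := by
  rw [reflectWeightRight_apply, if_neg (not_forall_mem_crossEdge hL hx)]

/-- `w^R = w` on the right bonds. [cite: LiebNachtergaele1995, §3] -/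
theorem reflectWeightRight_of_forall_not_mem (w : Sym2 (TorusSite d L) → ℝ)
    {e : Sym2 (TorusSite d L)} (he : ∀ x ∈ e, x ∉ torusLeftHalf L j a) :
    reflectWeightRight L j a w e = w e := by
  rw [reflectWeightRight_apply, if_neg (not_forall_mem_of_forall_not_mem he)]

/-- `w^R ∘ θ = w ∘ θ` on the left bonds. [cite: LiebNachtergaele1995, §3] -/
theorem reflectWeightRight_map_of_mem_torusLeftEdges (hL : Even L) (w : Sym2 (TorusSite d L) → ℝ)
    {e : Sym2 (TorusSite d L)} (he : e ∈ torusLeftEdges L j a) :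
    reflectWeightRight L j a w (e.map (Torus.reflectBetweenSites j a)) =
      w (e.map (Torus.reflectBetweenSites j a)) :=
  reflectWeightRight_of_forall_not_mem w (forall_not_mem_map_of_mem_torusLeftEdges hL he)

/-- `w^R ∘ θ = w` on the crossing bonds. [cite: LiebNachtergaele1995, §3] -/
theorem reflectWeightRight_map_crossEdge (hL : Even L) (w : Sym2 (TorusSite d L) → ℝ)
    {x : TorusSite d L} (hx : x ∈ torusCrossSites L j a) :
    reflectWeightRight L j a w ((s(x, Torus.reflectBetweenSites j a x) : Sym2 (TorusSite d L)).map
        (Torus.reflectBetweenSites j a)) = w s(x, Torus.reflectBetweenSites j a x) := by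
  rw [map_crossEdge, reflectWeightRight_crossEdge hL w hx]

end Weights

/-! ### Dependence of the half-space operators on the couplings -/

section Congr

variable {L : ℕ} [NeZero L] {j : Fin d} {a : ZMod L} {hL : Even L} {n : ℕ}

/-- `A_w(h)` depends on `w` only through the left and crossing couplings. [cite: KLS1988JSP, eq. (21)] -/
theorem xyWeightedLeftHamiltonian_congr_weight {w₁ w₂ : Sym2 (TorusSite d L) → ℝ}
    (hw : ∀ e ∈ torusLeftEdges L j a, w₁ e = w₂ e)
    (hc : ∀ x ∈ torusCrossSites L j a,
      w₁ s(x, Torus.reflectBetweenSites j a x) = w₂ s(x, Torus.reflectBetweenSites j a x))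
    (h : TorusSite d L → ℝ) :
    xyWeightedLeftHamiltonian L j a hL n w₁ h = xyWeightedLeftHamiltonian L j a hL n w₂ h := by
  unfold xyWeightedLeftHamiltonian
  congr 1
  · exact sum_congr rfl fun e he => by rw [hw e he]
  · exact sum_congr rfl fun x hx => by rw [hc x hx]

/-- `Z_w` depends on `w` only through the left couplings. [cite: DLS1978, Lemma 6.1] -/
theorem zzWeightedLeft_congr_weight {w₁ w₂ : Sym2 (TorusSite d L) → ℝ}
    (hw : ∀ e ∈ torusLeftEdges L j a, w₁ e = w₂ e) :
    zzWeightedLeft L j a hL n w₁ = zzWeightedLeft L j a hL n w₂ := by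
  unfold zzWeightedLeft
  exact sum_congr rfl fun e he => by rw [hw e he]

/-- `A_w(h) - Z_w` depends on `w` only through the left and crossing couplings, and on `h` only
through the left half. [cite: KLS1988JSP, eq. (21)] -/
theorem heisWeightedLeftHamiltonian_congr_weight {w₁ w₂ : Sym2 (TorusSite d L) → ℝ}
    (hw : ∀ e ∈ torusLeftEdges L j a, w₁ e = w₂ e)
    (hc : ∀ x ∈ torusCrossSites L j a,
      w₁ s(x, Torus.reflectBetweenSites j a x) = w₂ s(x, Torus.reflectBetweenSites j a x))
    {h₁ h₂ : TorusSite d L → ℝ} (hh : ∀ x ∈ torusLeftHalf L j a, h₁ x = h₂ x) :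
    heisWeightedLeftHamiltonian L j a hL n w₁ h₁ = heisWeightedLeftHamiltonian L j a hL n w₂ h₂ := by
  rw [heisWeightedLeftHamiltonian, heisWeightedLeftHamiltonian,
    xyWeightedLeftHamiltonian_congr_weight hw hc, zzWeightedLeft_congr_weight hw,
    xyWeightedLeftHamiltonian_congr w₂ hh]

/-- The weighted crossing operators depend on `w` only through the crossing couplings, and on
`h` only through the left half. [cite: KLS1988JSP, eqs. (20)–(21)] -/
theorem heisWeightedCrossOp_congr_weight {w₁ w₂ : Sym2 (TorusSite d L) → ℝ}
    (hc : ∀ x ∈ torusCrossSites L j a,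
      w₁ s(x, Torus.reflectBetweenSites j a x) = w₂ s(x, Torus.reflectBetweenSites j a x))
    {h₁ h₂ : TorusSite d L → ℝ} (hh : ∀ x ∈ torusLeftHalf L j a, h₁ x = h₂ x) :
    heisWeightedCrossOp L j a hL n w₁ h₁ = heisWeightedCrossOp L j a hL n w₂ h₂ := by
  rw [← heisWeightedCrossOp_congr w₂ hh]
  funext i
  rcases i with i | x
  · simp only [heisWeightedCrossOp, Sum.elim_inl, xyWeightedCrossOp, hc _ i.1.2]
  · simp only [heisWeightedCrossOp, Sum.elim_inr, zzWeightedCrossOp, hc _ x.2]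

end Congr

/-! ### The Kronecker form for arbitrary couplings -/

section Halves

variable (L : ℕ) [NeZero L] (j : Fin d) (a : ZMod L) (hL : Even L) (n : ℕ)

/-- **The Kronecker form of the weighted rotated XY field Hamiltonian, arbitrary couplings**:
`H♭_w(g) = A_w(g) ⊗ 1 + 1 ⊗ A_{w∘θ}(g∘θ) - Σᵢ (√w Mᵢ(g)) ⊗ (√w Mᵢ(g∘θ))` (the right half is the
left Hamiltonian of the pulled-back couplings `w ∘ θ`). [cite: KLS1988JSP, eqs. (20)–(21)] -/
theorem xyWeightedRealFieldHamiltonian_eq_submatrix_general {w : Sym2 (TorusSite d L) → ℝ}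
    (hw0 : ∀ x ∈ torusCrossSites L j a, 0 ≤ w s(x, Torus.reflectBetweenSites j a x))
    (g : TorusSite d L → ℝ) :
    xyWeightedRealFieldHamiltonian L n w g =
      (xyWeightedLeftHamiltonian L j a hL n w g ⊗ₖ (1 : Op (torusLeftHalf L j a) (n + 1)) +
          (1 : Op (torusLeftHalf L j a) (n + 1)) ⊗ₖ
            xyWeightedLeftHamiltonian L j a hL n (fun e => w (e.map (Torus.reflectBetweenSites j a)))
              (fun y => g (Torus.reflectBetweenSites j a y)) -
          ∑ i, xyWeightedCrossOp L j a hL n w g i ⊗ₖ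
            xyWeightedCrossOp L j a hL n w (fun y => g (Torus.reflectBetweenSites j a y)) i).submatrix
        (torusSplit L j a hL) (torusSplit L j a hL) := by
  rw [submatrix_kroneckerForm, xyWeightedRealFieldHamiltonian, sum_edgeFinset_split L j a hL]
  -- names for the half-space summands
  set TL : Sym2 (TorusSite d L) → Op (torusLeftHalf L j a) (n + 1) := fun e =>
    Sym2.lift ⟨fun x y => xyRealBond n (fun z : torusLeftHalf L j a => g z)
      (torusToLeft L j a hL x) (torusToLeft L j a hL y),
      fun x y => xyRealBond_comm n _ _ _⟩ e with hTL
  set TR : Sym2 (TorusSite d L) → Op (torusLeftHalf L j a) (n + 1) := fun e =>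
    Sym2.lift ⟨fun x y => xyRealBond n (fun z : torusLeftHalf L j a => g (Torus.reflectBetweenSites j a z))
      (torusToLeft L j a hL x) (torusToLeft L j a hL y),
      fun x y => xyRealBond_comm n _ _ _⟩ e with hTR
  -- (1) left bonds
  have h1 : ∑ e ∈ torusLeftEdges L j a, ((w e : ℝ) : ℂ) •
      Sym2.lift ⟨fun x y => xyRealBond n g x y, fun x y => xyRealBond_comm n g x y⟩ e =
        torusLeftEmbed L j a hL (∑ e ∈ torusLeftEdges L j a, ((w e : ℝ) : ℂ) • TL e) := by
    rw [map_sum]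
    refine sum_congr rfl fun e he => ?_
    rw [map_smul]
    congr 1
    obtain ⟨-, hl⟩ := mem_filter.1 he
    revert hl
    refine Sym2.ind (fun x y => ?_) e
    intro hl
    simp only [hTL, Sym2.lift_mk]
    exact xyRealBond_eq_torusLeftEmbed n g (hl x (Sym2.mem_mk_left x y))
      (hl y (Sym2.mem_mk_right x y))
  -- (2) right bonds: the left bonds of the pulled-back couplings
  have h2 : ∑ e ∈ ((torusGraph d L).edgeFinset.filter fun e => ∀ x ∈ e, x ∉ torusLeftHalf L j a),
      ((w e : ℝ) : ℂ) •
        Sym2.lift ⟨fun x y => xyRealBond n g x y, fun x y => xyRealBond_comm n g x y⟩ e =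
        torusRightEmbed L j a hL (∑ e ∈ torusLeftEdges L j a,
          ((w (e.map (Torus.reflectBetweenSites j a)) : ℝ) : ℂ) • TR e) := by
    rw [sum_rightEdges_eq_sum_leftEdges_map L j a hL, map_sum]
    refine sum_congr rfl fun e he => ?_
    rw [map_smul]
    congr 1
    obtain ⟨-, hl⟩ := mem_filter.1 he
    revert hl
    refine Sym2.ind (fun x y => ?_) e
    intro hl
    have hx : Torus.reflectBetweenSites j a x ∉ torusLeftHalf L j a := fun h' =>
      (reflectBetweenSites_mem_torusLeftHalf_iff L j a hL x).1 h' (hl x (Sym2.mem_mk_left x y))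
    have hy : Torus.reflectBetweenSites j a y ∉ torusLeftHalf L j a := fun h' =>
      (reflectBetweenSites_mem_torusLeftHalf_iff L j a hL y).1 h' (hl y (Sym2.mem_mk_right x y))
    simp only [hTR, Sym2.map_mk, Sym2.lift_mk]
    rw [xyRealBond_eq_torusRightEmbed n g hx hy, torusToLeft_reflectBetweenSites,
      torusToLeft_reflectBetweenSites]
  -- (3) crossing bonds
  have h3 : ∑ x ∈ torusCrossSites L j a, ((w s(x, Torus.reflectBetweenSites j a x) : ℝ) : ℂ) •
      Sym2.lift ⟨fun x y => xyRealBond n g x y, fun x y => xyRealBond_comm n g x y⟩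
        s(x, Torus.reflectBetweenSites j a x) =
      torusLeftEmbed L j a hL (∑ x ∈ torusCrossSites L j a,
          ((w s(x, Torus.reflectBetweenSites j a x) : ℝ) : ℂ) •
          ((((g x) ^ 2 / 2 : ℝ) : ℂ) • (1 : Op (torusLeftHalf L j a) (n + 1)) -
            ((g x : ℝ) : ℂ) • siteSpin n (torusToLeft L j a hL x) 0)) +
        torusRightEmbed L j a hL (∑ x ∈ torusCrossSites L j a,
          ((w s(x, Torus.reflectBetweenSites j a x) : ℝ) : ℂ) •
          ((((g (Torus.reflectBetweenSites j a x)) ^ 2 / 2 : ℝ) : ℂ) • (1 : Op (torusLeftHalf L j a) (n + 1)) -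
            ((g (Torus.reflectBetweenSites j a x) : ℝ) : ℂ) • siteSpin n (torusToLeft L j a hL x) 0)) -
        ∑ i : torusCrossSites L j a × Bool, torusLeftEmbed L j a hL (xyWeightedCrossOp L j a hL n w g i) *
          torusRightEmbed L j a hL
            (xyWeightedCrossOp L j a hL n w (fun y => g (Torus.reflectBetweenSites j a y)) i) := by
    rw [map_sum, map_sum, Fintype.sum_prod_type]
    simp only [Fintype.sum_bool]
    rw [← Finset.sum_coe_sort (torusCrossSites L j a), ← Finset.sum_coe_sort (torusCrossSites L j a),
      ← Finset.sum_coe_sort (torusCrossSites L j a), ← sum_add_distrib, ← sum_sub_distrib]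
    refine sum_congr rfl fun x _ => ?_
    have hsq : ((Real.sqrt (w s((x : TorusSite d L), Torus.reflectBetweenSites j a x)) : ℝ) : ℂ) *
        ((Real.sqrt (w s((x : TorusSite d L), Torus.reflectBetweenSites j a x)) : ℝ) : ℂ) =
        ((w s((x : TorusSite d L), Torus.reflectBetweenSites j a x) : ℝ) : ℂ) := by
      rw [← Complex.ofReal_mul, Real.mul_self_sqrt (hw0 _ x.2)]
    simp only [Sym2.lift_mk]
    rw [xyRealBond_cross (hL := hL) n g x, map_smul, map_smul]
    simp only [xyWeightedCrossOp, map_smul, smul_mul_smul_comm, hsq, smul_add, smul_sub]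
  -- the crossing couplings of `w ∘ θ` are those of `w`
  have hB : xyWeightedLeftHamiltonian L j a hL n (fun e => w (e.map (Torus.reflectBetweenSites j a)))
      (fun y => g (Torus.reflectBetweenSites j a y)) =
      (∑ e ∈ torusLeftEdges L j a, ((w (e.map (Torus.reflectBetweenSites j a)) : ℝ) : ℂ) • TR e) +
      ∑ x ∈ torusCrossSites L j a, ((w s(x, Torus.reflectBetweenSites j a x) : ℝ) : ℂ) •
        ((((g (Torus.reflectBetweenSites j a x)) ^ 2 / 2 : ℝ) : ℂ) • (1 : Op (torusLeftHalf L j a) (n + 1)) -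
          ((g (Torus.reflectBetweenSites j a x) : ℝ) : ℂ) • siteSpin n (torusToLeft L j a hL x) 0) := by
    unfold xyWeightedLeftHamiltonian
    congr 1
    exact sum_congr rfl fun x _ => by simp only [map_crossEdge]
  rw [h1, h2, h3, xyWeightedLeftHamiltonian, hB, map_add, map_add]
  abel

/-- **The Kronecker form of the weighted `S³S³` bond sum, arbitrary couplings**:
`Σ_{⟨xy⟩} w S³S³ = Z_w ⊗ 1 + 1 ⊗ Z_{w∘θ} + Σ_{x crossing} (√w T³_x) ⊗ (√w T³_x)`.
[cite: DLS1978, Lemma 6.1, Thm. 6.1] -/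
theorem zzWeighted_eq_embed_general {w : Sym2 (TorusSite d L) → ℝ}
    (hw0 : ∀ x ∈ torusCrossSites L j a, 0 ≤ w s(x, Torus.reflectBetweenSites j a x)) :
    zzWeighted L n w =
      torusLeftEmbed L j a hL (zzWeightedLeft L j a hL n w) +
        torusRightEmbed L j a hL
          (zzWeightedLeft L j a hL n (fun e => w (e.map (Torus.reflectBetweenSites j a)))) +
        ∑ x : torusCrossSites L j a,
          torusLeftEmbed L j a hL (zzWeightedCrossOp L j a hL n w x) *
            torusRightEmbed L j a hL (zzWeightedCrossOp L j a hL n w x) := by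
  rw [zzWeighted, sum_edgeFinset_split L j a hL]
  set T : Sym2 (TorusSite d L) → Op (torusLeftHalf L j a) (n + 1) := fun e =>
    Sym2.lift ⟨fun x y => spinBond n 2 (torusToLeft L j a hL x) (torusToLeft L j a hL y),
      fun _ _ => spinBond_two_symm n _ _⟩ e with hT
  -- (1) left bonds
  have h1 : ∑ e ∈ torusLeftEdges L j a, ((w e : ℝ) : ℂ) •
      Sym2.lift ⟨fun x y => spinBond n 2 x y, spinBond_two_symm n⟩ e =
        torusLeftEmbed L j a hL (∑ e ∈ torusLeftEdges L j a, ((w e : ℝ) : ℂ) • T e) := by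
    rw [map_sum]
    refine sum_congr rfl fun e he => ?_
    rw [map_smul]
    congr 1
    obtain ⟨-, hl⟩ := mem_filter.1 he
    revert hl
    refine Sym2.ind (fun x y => ?_) e
    intro hl
    simp only [hT, Sym2.lift_mk]
    exact spinBond_two_eq_torusLeftEmbed (hl x (Sym2.mem_mk_left x y))
      (hl y (Sym2.mem_mk_right x y))
  -- (2) right bonds
  have h2 : ∑ e ∈ ((torusGraph d L).edgeFinset.filter fun e => ∀ x ∈ e, x ∉ torusLeftHalf L j a),
      ((w e : ℝ) : ℂ) • Sym2.lift ⟨fun x y => spinBond n 2 x y, spinBond_two_symm n⟩ e =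
        torusRightEmbed L j a hL (∑ e ∈ torusLeftEdges L j a,
          ((w (e.map (Torus.reflectBetweenSites j a)) : ℝ) : ℂ) • T e) := by
    rw [sum_rightEdges_eq_sum_leftEdges_map L j a hL, map_sum]
    refine sum_congr rfl fun e he => ?_
    rw [map_smul]
    congr 1
    obtain ⟨-, hl⟩ := mem_filter.1 he
    revert hl
    refine Sym2.ind (fun x y => ?_) e
    intro hl
    have hx : Torus.reflectBetweenSites j a x ∉ torusLeftHalf L j a := fun h' =>
      (reflectBetweenSites_mem_torusLeftHalf_iff L j a hL x).1 h' (hl x (Sym2.mem_mk_left x y))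
    have hy : Torus.reflectBetweenSites j a y ∉ torusLeftHalf L j a := fun h' =>
      (reflectBetweenSites_mem_torusLeftHalf_iff L j a hL y).1 h' (hl y (Sym2.mem_mk_right x y))
    simp only [hT, Sym2.map_mk, Sym2.lift_mk]
    rw [spinBond_two_eq_torusRightEmbed hx hy, torusToLeft_reflectBetweenSites,
      torusToLeft_reflectBetweenSites]
  -- (3) crossing bonds
  have h3 : ∑ x ∈ torusCrossSites L j a, ((w s(x, Torus.reflectBetweenSites j a x) : ℝ) : ℂ) •
      Sym2.lift ⟨fun x y => spinBond n 2 x y, spinBond_two_symm n⟩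
        s(x, Torus.reflectBetweenSites j a x) =
      ∑ x : torusCrossSites L j a,
          torusLeftEmbed L j a hL (zzWeightedCrossOp L j a hL n w x) *
            torusRightEmbed L j a hL (zzWeightedCrossOp L j a hL n w x) := by
    rw [← Finset.sum_coe_sort (torusCrossSites L j a)]
    refine sum_congr rfl fun x _ => ?_
    have hsq : ((Real.sqrt (w s((x : TorusSite d L), Torus.reflectBetweenSites j a x)) : ℝ) : ℂ) *
        ((Real.sqrt (w s((x : TorusSite d L), Torus.reflectBetweenSites j a x)) : ℝ) : ℂ) =
        ((w s((x : TorusSite d L), Torus.reflectBetweenSites j a x) : ℝ) : ℂ) := by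
      rw [← Complex.ofReal_mul, Real.mul_self_sqrt (hw0 _ x.2)]
    simp only [Sym2.lift_mk]
    rw [spinBond_two_cross (hL := hL) x]
    simp only [zzWeightedCrossOp, map_smul, smul_mul_smul_comm, hsq]
  rw [h1, h2, h3, zzWeightedLeft, zzWeightedLeft]

/-- **The Kronecker form of the weighted rotated field Hamiltonian of the antiferromagnet,
arbitrary couplings**: `H♭_w(g) = (A_w(g) - Z_w) ⊗ 1 + 1 ⊗ (A_{w∘θ}(g∘θ) - Z_{w∘θ}) - Σᵢ Mᵢ ⊗ Nᵢ`;
only the crossing couplings (which `θ` fixes) are assumed nonnegative.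
[cite: LiebNachtergaele1995, §3 (proof of Theorem 4)] [cite: KLS1988JSP, eqs. (20)–(21)] -/
theorem heisWeightedRealFieldHamiltonian_eq_submatrix_general {w : Sym2 (TorusSite d L) → ℝ}
    (hw0 : ∀ x ∈ torusCrossSites L j a, 0 ≤ w s(x, Torus.reflectBetweenSites j a x))
    (g : TorusSite d L → ℝ) :
    heisWeightedRealFieldHamiltonian L n w g =
      (heisWeightedLeftHamiltonian L j a hL n w g ⊗ₖ (1 : Op (torusLeftHalf L j a) (n + 1)) +
          (1 : Op (torusLeftHalf L j a) (n + 1)) ⊗ₖ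
            heisWeightedLeftHamiltonian L j a hL n (fun e => w (e.map (Torus.reflectBetweenSites j a)))
              (fun y => g (Torus.reflectBetweenSites j a y)) -
          ∑ i, heisWeightedCrossOp L j a hL n w g i ⊗ₖ
            heisWeightedCrossOp L j a hL n w (fun y => g (Torus.reflectBetweenSites j a y)) i).submatrix
        (torusSplit L j a hL) (torusSplit L j a hL) := by
  rw [submatrix_kroneckerForm, heisWeightedRealFieldHamiltonian_eq_sub,
    xyWeightedRealFieldHamiltonian_eq_submatrix_general L j a hL n hw0 g, submatrix_kroneckerForm,
    zzWeighted_eq_embed_general L j a hL n hw0, Fintype.sum_sum_type]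
  simp only [heisWeightedCrossOp, heisWeightedLeftHamiltonian, Sum.elim_inl, Sum.elim_inr, map_sub]
  abel

end Halves

/-! ### The reflection inequality in the couplings -/

section Reflection

variable (L : ℕ) [NeZero L] (j : Fin d) (a : ZMod L) (n : ℕ)

/-- **Reflection positivity of the antiferromagnet in the couplings and the field**: for couplings
nonnegative on the bonds crossing the chosen planes and every real field `h`,
`½(E₀(H_{w^L}(h^L)) + E₀(H_{w^R}(h^R))) ≤ E₀(H_w(h))` on the torus `(ℤ/Lℤ)^d` of even side `L ≥ 4`,
any spin `n/2` — the Kennedy–Lieb–Shastry form of the Dyson–Lieb–Simon inequality with the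
reflection acting on the couplings as well. [cite: LiebNachtergaele1995, §3 (proof of Theorem 4)]
[cite: KLS1988JSP, eqs. (20)–(25)] [cite: DLS1978, Lemma 4.1, Thm. 6.1] -/
theorem heis_groundEnergy_reflectWeight_le (hL : Even L) (hL3 : 3 ≤ L)
    {w : Sym2 (TorusSite d L) → ℝ}
    (hw0 : ∀ x ∈ torusCrossSites L j a, 0 ≤ w s(x, Torus.reflectBetweenSites j a x))
    (h : TorusSite d L → ℝ) :
    ((heisWeightedFieldHamiltonian L n (reflectWeightLeft L j a w) (reflectFieldLeft L j a h)).groundEnergy +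
        (heisWeightedFieldHamiltonian L n (reflectWeightRight L j a w)
          (reflectFieldRight L j a h)).groundEnergy) / 2 ≤
      (heisWeightedFieldHamiltonian L n w h).groundEnergy := by
  rw [groundEnergy_heisWeightedFieldHamiltonian_eq L hL hL3,
    groundEnergy_heisWeightedFieldHamiltonian_eq L hL hL3,
    groundEnergy_heisWeightedFieldHamiltonian_eq L hL hL3]
  -- abbreviations
  set A := heisWeightedLeftHamiltonian L j a hL n w h with hA
  set B := heisWeightedLeftHamiltonian L j a hL n (fun e => w (e.map (Torus.reflectBetweenSites j a)))
    (fun y => h (Torus.reflectBetweenSites j a y)) with hB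
  set M := heisWeightedCrossOp L j a hL n w h with hM
  set N := heisWeightedCrossOp L j a hL n w (fun y => h (Torus.reflectBetweenSites j a y)) with hN
  set e := torusSplit (q := n + 1) L j a hL with he
  -- coupling bookkeeping
  have hwL0 : ∀ x ∈ torusCrossSites L j a,
      0 ≤ reflectWeightLeft L j a w s(x, Torus.reflectBetweenSites j a x) :=
    fun x hx => by rw [reflectWeightLeft_crossEdge w hx]; exact hw0 x hx
  have hwR0 : ∀ x ∈ torusCrossSites L j a,
      0 ≤ reflectWeightRight L j a w s(x, Torus.reflectBetweenSites j a x) :=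
    fun x hx => by rw [reflectWeightRight_crossEdge hL w hx]; exact hw0 x hx
  -- the three Kronecker forms
  have hK : heisWeightedRealFieldHamiltonian L n w h =
      (A ⊗ₖ 1 + 1 ⊗ₖ B - ∑ i, M i ⊗ₖ N i).submatrix e e :=
    heisWeightedRealFieldHamiltonian_eq_submatrix_general L j a hL n hw0 h
  have hKL : heisWeightedRealFieldHamiltonian L n (reflectWeightLeft L j a w) (reflectFieldLeft L j a h) =
      (A ⊗ₖ 1 + 1 ⊗ₖ A - ∑ i, M i ⊗ₖ M i).submatrix e e := by
    rw [heisWeightedRealFieldHamiltonian_eq_submatrix_general L j a hL n hwL0,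
      heisWeightedLeftHamiltonian_congr_weight (w₂ := w)
        (fun e he => reflectWeightLeft_of_mem_torusLeftEdges w he)
        (fun x hx => reflectWeightLeft_crossEdge w hx)
        (fun x hx => reflectFieldLeft_of_mem L j a h hx),
      heisWeightedLeftHamiltonian_congr_weight (w₂ := w)
        (fun e he => reflectWeightLeft_map_of_mem_torusLeftEdges hL w he)
        (fun x hx => reflectWeightLeft_map_crossEdge w hx)
        (fun x hx => reflectFieldLeft_reflectBetweenSites_of_mem L j a hL h hx),
      heisWeightedCrossOp_congr_weight (w₂ := w) (fun x hx => reflectWeightLeft_crossEdge w hx)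
        (fun x hx => reflectFieldLeft_of_mem L j a h hx),
      heisWeightedCrossOp_congr_weight (w₂ := w) (fun x hx => reflectWeightLeft_crossEdge w hx)
        (fun x hx => reflectFieldLeft_reflectBetweenSites_of_mem L j a hL h hx)]
  have hKR : heisWeightedRealFieldHamiltonian L n (reflectWeightRight L j a w) (reflectFieldRight L j a h) =
      (B ⊗ₖ 1 + 1 ⊗ₖ B - ∑ i, N i ⊗ₖ N i).submatrix e e := by
    rw [heisWeightedRealFieldHamiltonian_eq_submatrix_general L j a hL n hwR0,
      heisWeightedLeftHamiltonian_congr_weight (w₂ := fun e => w (e.map (Torus.reflectBetweenSites j a)))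
        (fun e he => reflectWeightRight_of_mem_torusLeftEdges w he)
        (fun x hx => by rw [reflectWeightRight_crossEdge hL w hx]; simp only [map_crossEdge])
        (fun x hx => reflectFieldRight_of_mem L j a h hx),
      heisWeightedLeftHamiltonian_congr_weight (w₂ := fun e => w (e.map (Torus.reflectBetweenSites j a)))
        (h₁ := fun y => reflectFieldRight L j a h (Torus.reflectBetweenSites j a y))
        (fun e he => reflectWeightRight_map_of_mem_torusLeftEdges hL w he)
        (fun x hx => by rw [reflectWeightRight_map_crossEdge hL w hx]; simp only [map_crossEdge])
        (fun x hx => reflectFieldRight_reflectBetweenSites_of_mem L j a hL h hx),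
      heisWeightedCrossOp_congr_weight (w₂ := w) (fun x hx => reflectWeightRight_crossEdge hL w hx)
        (fun x hx => reflectFieldRight_of_mem L j a h hx),
      heisWeightedCrossOp_congr_weight (w₂ := w)
        (h₁ := fun y => reflectFieldRight L j a h (Torus.reflectBetweenSites j a y))
        (fun x hx => reflectWeightRight_crossEdge hL w hx)
        (fun x hx => reflectFieldRight_reflectBetweenSites_of_mem L j a hL h hx)]
  -- Hermiticity of the three forms
  have herm : ∀ (w' : Sym2 (TorusSite d L) → ℝ) (f : TorusSite d L → ℝ) (K : Matrix _ _ ℂ),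
      heisWeightedRealFieldHamiltonian L n w' f = K.submatrix e e → K.IsHermitian := by
    intro w' f K hf
    have : K = (heisWeightedRealFieldHamiltonian L n w' f).submatrix e.symm e.symm := by
      rw [hf, submatrix_submatrix, Equiv.self_comp_symm, submatrix_id_id]
    rw [this]
    exact (heisWeightedRealFieldHamiltonian_isHermitian L n w' f).submatrix _
  haveI : Nonempty ((torusLeftHalf L j a → Fin (n + 1)) × (torusLeftHalf L j a → Fin (n + 1))) :=
    ⟨(fun _ => 0, fun _ => 0)⟩
  have hRP := Matrix.kls_groundEnergy_reflection A B M N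
    (heisWeightedLeftHamiltonian_transpose w h) (heisWeightedLeftHamiltonian_transpose _ _)
    (fun i => heisWeightedCrossOp_transpose_eq w h i) (fun i => heisWeightedCrossOp_transpose_eq w _ i)
    (herm _ _ _ hK) (herm _ _ _ hKL) (herm _ _ _ hKR)
  rw [hK, hKL, hKR, Matrix.groundEnergy_submatrix_equiv (herm _ _ _ hK),
    Matrix.groundEnergy_submatrix_equiv (herm _ _ _ hKL),
    Matrix.groundEnergy_submatrix_equiv (herm _ _ _ hKR)]
  exact hRP

/-- The reflected zero field is zero. [cite: KLS1988JSP, p. 1029] -/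
theorem reflectFieldLeft_zero : reflectFieldLeft L j a (fun _ : TorusSite d L => (0 : ℝ)) = fun _ => 0 := by
  funext y; simp [reflectFieldLeft]

/-- The reflected zero field is zero. [cite: KLS1988JSP, p. 1029] -/
theorem reflectFieldRight_zero : reflectFieldRight L j a (fun _ : TorusSite d L => (0 : ℝ)) = fun _ => 0 := by
  funext y; simp [reflectFieldRight]

/-- **Lieb–Nachtergaele's reflection inequality for the couplings of the antiferromagnet**
(zero field): for couplings `J = w ≥ 0` on the bonds crossing the planes,
`λ₀(H(J^l, J^m, J^r)) ≥ ½(λ₀(H(J^l, J^m, θJ^l)) + λ₀(H(θJ^r, J^m, J^r)))` for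
`H_w = Σ_{⟨xy⟩} w_{xy} 𝐒_x·𝐒_y` on the torus `(ℤ/Lℤ)^d` of even side `L ≥ 4`, any spin.
[cite: LiebNachtergaele1995, §3 (proof of Theorem 4, displayed inequality)] [cite: DLS1978, Thm. 6.1] -/
theorem heis_groundEnergy_reflectWeight_le_zero (hL : Even L) (hL3 : 3 ≤ L)
    {w : Sym2 (TorusSite d L) → ℝ}
    (hw0 : ∀ x ∈ torusCrossSites L j a, 0 ≤ w s(x, Torus.reflectBetweenSites j a x)) :
    ((heisWeightedHamiltonian L n (reflectWeightLeft L j a w)).groundEnergy +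
        (heisWeightedHamiltonian L n (reflectWeightRight L j a w)).groundEnergy) / 2 ≤
      (heisWeightedHamiltonian L n w).groundEnergy := by
  have h := heis_groundEnergy_reflectWeight_le L j a n hL hL3 hw0 (fun _ => 0)
  rwa [reflectFieldLeft_zero, reflectFieldRight_zero, heisWeightedFieldHamiltonian_zero,
    heisWeightedFieldHamiltonian_zero, heisWeightedFieldHamiltonian_zero] at h

end Reflection

end Literature.MathematicalPhysics.QuantumLattice

end
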